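import Mathlib

/-!
# Crux `GrenetZeon.TwoDimCoefficients` (stmt-ValiantsHypothesis-8062) / rung `DualUnipotentThreeHalves`
# (stmt-ValiantsHypothesis-24318): PROJECTOR CALCULUS for layered pencils — the path-matrix ingredients of
# «(H) HessianRate on the layered family» (note `HESSIAN-RATE-LAYERED.md` §2–3, §6(i))

Companion of ✓ `…DualUnipotentStaircase` (p824982/p825039/§3).  The note proves conjecture (H) (hypothesis of
✓ `threeHalves_of_hessianRate`) with `C = 2` on every pencil that is block-superdiagonal for a level function
with `d+1` levels.  Its kernel port (§6(i)) is best run in the AMBIENT `M_m(K)` with the LEVEL PROJECTORS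
`D_ℓ = diag[lvl = ℓ]` instead of dependent block sizes; the whole path bookkeeping then follows from ONE
commutation rule, `D_ℓ·A = A·D_{ℓ+1}` for a levelled `A`.  This file types that calculus, def-free (the
projector family is an arbitrary `D : ℕ → M` satisfying the rule; the diagonal indicator family is shown to
satisfy it):

* `diagonal_level_mul_eq` — for `A` levelled (`A a b ≠ 0 → lvl b = lvl a + 1`):
  `diag[lvl = ℓ]·A = A·diag[lvl = ℓ+1]`; `rank_diagonal_level` — `rank diag[lvl = ℓ] = #{lvl = ℓ}` (= `w_ℓ`).
* `intertwine_pow` — `D ℓ·A = A·D (ℓ+1)` for all `ℓ` ⟹ `D ℓ·A^k = A^k·D (ℓ+k)`;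
  `proj_mul_pow_add` — `D ℓ·A^(u+v) = A^u·D (ℓ+u)·A^v` (a path from level `ℓ` FACTORS THROUGH level `ℓ+u`);
  `rank_proj_mul_pow_add_mul_le` — hence `rank (D ℓ·A^(u+v)·Z) ≤ rank (D (ℓ+u))` for every `Z`
  (a product through a thin level has rank ≤ its width — the `≤ t` input of the staircase lemma).
* `range_toLin'_mul_le`, `range_toLin'_transpose_mul_le` — column spaces shrink under right multiplication,
  row spaces under left multiplication (the two NESTINGS of the staircase lemma).

HONEST FRAMING: bookkeeping lemmas (any field) for a kernel port that is NOT completed here; layered ⊂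
triangularisable, where the 3/2 conclusion is already known by flats; no stub, rung or crux is closed;
`DualUnipotentBound`, 24318, (c), `VP ≠ VNP` NOT proved.
-/

-- single-conjunct layout `Summits/ValiantsHypothesis/ValiantsHypothesis`: the duplicated namespace
-- component is mandated by the tree.
set_option linter.dupNamespace false

noncomputable section

namespace Summit.ValiantsHypothesis.ValiantsHypothesis.Cruxes.TwoDimCoefficients.DimTwoCases

open Matrix

variable {K : Type*} [Field K] {ι : Type*} [Fintype ι] [DecidableEq ι]

/-! ### The level projectors of a levelled matrix -/

/-- **Commutation rule.** If every non-zero entry `A a b` goes from level `lvl a` to level `lvl a + 1`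
(block-superdiagonal for the level function), then `diag[lvl = ℓ]·A = A·diag[lvl = ℓ+1]`. [folklore] -/
theorem diagonal_level_mul_eq (lvl : ι → ℕ) (A : Matrix ι ι K)
    (hA : ∀ a b, A a b ≠ 0 → lvl b = lvl a + 1) (ℓ : ℕ) :
    Matrix.diagonal (fun a => if lvl a = ℓ then (1 : K) else 0) * A =
      A * Matrix.diagonal (fun b => if lvl b = ℓ + 1 then (1 : K) else 0) := by
  ext a b
  rw [Matrix.diagonal_mul, Matrix.mul_diagonal]
  by_cases h : A a b = 0
  · simp [h]
  · have hl := hA a b h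
    by_cases ha : lvl a = ℓ
    · simp [ha, hl]
    · have hb : ¬ lvl b = ℓ + 1 := fun hb => ha (by omega)
      simp [ha, hb]

/-- The level projector `diag[lvl = ℓ]` has rank `#{a : lvl a = ℓ}` (the width of level `ℓ`). [folklore] -/
theorem rank_diagonal_level (lvl : ι → ℕ) (ℓ : ℕ) :
    (Matrix.diagonal (fun a => if lvl a = ℓ then (1 : K) else 0)).rank =
      Fintype.card {a : ι // lvl a = ℓ} := by
  classical
  rw [Matrix.rank_diagonal]
  exact Fintype.card_congr (Equiv.subtypeEquivRight fun a => by simp)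

/-! ### Intertwining calculus for an abstract projector family -/

/-- `D ℓ·A = A·D (ℓ+1)` for all `ℓ` implies `D ℓ·A^k = A^k·D (ℓ+k)`. [folklore] -/
theorem intertwine_pow (D : ℕ → Matrix ι ι K) (A : Matrix ι ι K) (hD : ∀ ℓ, D ℓ * A = A * D (ℓ + 1))
    (k ℓ : ℕ) : D ℓ * A ^ k = A ^ k * D (ℓ + k) := by
  induction k generalizing ℓ with
  | zero => rw [pow_zero, Matrix.one_mul, Matrix.mul_one, add_zero]
  | succ k ih =>
      rw [pow_succ', ← Matrix.mul_assoc, hD ℓ, Matrix.mul_assoc, ih (ℓ + 1), ← Matrix.mul_assoc]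
      congr 2
      omega

/-- **Factorisation through an intermediate level.** `D ℓ·A^(u+v) = A^u·D (ℓ+u)·A^v`. [folklore] -/
theorem proj_mul_pow_add (D : ℕ → Matrix ι ι K) (A : Matrix ι ι K) (hD : ∀ ℓ, D ℓ * A = A * D (ℓ + 1))
    (ℓ u v : ℕ) : D ℓ * A ^ (u + v) = A ^ u * D (ℓ + u) * A ^ v := by
  rw [pow_add, ← Matrix.mul_assoc, intertwine_pow D A hD u ℓ]

/-- Hence a path product leaving level `ℓ` has rank at most the width of every level it passes:
`rank (D ℓ·A^(u+v)·Z) ≤ rank (D (ℓ+u))`. [folklore] -/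
theorem rank_proj_mul_pow_add_mul_le (D : ℕ → Matrix ι ι K) (A : Matrix ι ι K)
    (hD : ∀ ℓ, D ℓ * A = A * D (ℓ + 1)) (ℓ u v : ℕ) (Z : Matrix ι ι K) :
    (D ℓ * A ^ (u + v) * Z).rank ≤ (D (ℓ + u)).rank := by
  rw [proj_mul_pow_add D A hD ℓ u v]
  calc (A ^ u * D (ℓ + u) * A ^ v * Z).rank ≤ (A ^ u * D (ℓ + u) * A ^ v).rank :=
        Matrix.rank_mul_le_left _ _
    _ ≤ (A ^ u * D (ℓ + u)).rank := Matrix.rank_mul_le_left _ _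
    _ ≤ (D (ℓ + u)).rank := Matrix.rank_mul_le_right _ _

/-- Dually, a path product ARRIVING at level `ℓ + u + v`... stated from the left: `rank (Z·A^(u+v)·D ℓ')`
is at most the width of an intermediate level, in the form `Z·A^u·D ℓ·A^v` has rank `≤ rank (D ℓ)`.
[folklore] -/
theorem rank_mul_pow_mul_proj_mul_pow_le (D : ℕ → Matrix ι ι K) (A Z : Matrix ι ι K) (ℓ u v : ℕ) :
    (Z * A ^ u * D ℓ * A ^ v).rank ≤ (D ℓ).rank := by
  calc (Z * A ^ u * D ℓ * A ^ v).rank ≤ (Z * A ^ u * D ℓ).rank := Matrix.rank_mul_le_left _ _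
    _ ≤ (D ℓ).rank := Matrix.rank_mul_le_right _ _

/-! ### The two nestings -/

omit [Fintype ι] [DecidableEq ι] in
/-- Column spaces shrink under right multiplication: `colsp(M·A) ≤ colsp(M)`. [folklore] -/
theorem range_toLin'_mul_le {κ μ : Type*} [Fintype κ] [DecidableEq κ] [Fintype μ] [DecidableEq μ]
    (M : Matrix ι κ K) (A : Matrix κ μ K) :
    LinearMap.range (Matrix.toLin' (M * A)) ≤ LinearMap.range (Matrix.toLin' M) := by
  rw [Matrix.toLin'_mul]
  exact LinearMap.range_comp_le_range _ _

omit [Fintype ι] [DecidableEq ι] in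
/-- Row spaces shrink under left multiplication: `rowsp(A·M) ≤ rowsp(M)` (row space = column space of
the transpose). [folklore] -/
theorem range_toLin'_transpose_mul_le {κ μ : Type*} [Fintype κ] [DecidableEq κ] [Fintype μ] [DecidableEq μ]
    (A : Matrix μ κ K) (M : Matrix κ ι K) :
    LinearMap.range (Matrix.toLin' (A * M)ᵀ) ≤ LinearMap.range (Matrix.toLin' Mᵀ) := by
  rw [Matrix.transpose_mul]
  exact range_toLin'_mul_le _ _

/-! ### §2 (appended) CLOSED FORMS for the port (note §8 addendum): the algebra of the concrete level
projectors `D ℓ = diag[lvl = ℓ]`, the decomposition of a levelled direction, `A^(d+1) = 0`, and the four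
path blocks `D_{i+1}·P·D_j`, `E·P·D_i`, `D_{j+1}·P·E` (`P = Σ_{k≤d} A^k`) in closed form.  Throughout the
projector family is an abstract `D` together with the hypothesis `hD : ∀ ℓ, D ℓ = diag[lvl = ℓ]` (keeps the
statements short and the file def-free). -/

section ClosedForms

variable (lvl : ι → ℕ) (D : ℕ → Matrix ι ι K)

/-- `D a · D b = [a = b]·D a`: distinct level projectors are orthogonal. [folklore] -/
theorem levelProj_mul_levelProj_of_ne (hD : ∀ ℓ, D ℓ = Matrix.diagonal fun a => if lvl a = ℓ then (1 : K) else 0)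
    {a b : ℕ} (hab : a ≠ b) : D a * D b = 0 := by
  rw [hD a, hD b, Matrix.diagonal_mul_diagonal, ← Matrix.diagonal_zero]
  congr 1
  funext x
  by_cases hx : lvl x = a
  · simp [hx, hab]
  · simp [hx]

/-- `D a · D a = D a`. [folklore] -/
theorem levelProj_mul_self (hD : ∀ ℓ, D ℓ = Matrix.diagonal fun a => if lvl a = ℓ then (1 : K) else 0)
    (a : ℕ) : D a * D a = D a := by
  rw [hD a, Matrix.diagonal_mul_diagonal]
  congr 1
  funext x
  by_cases hx : lvl x = a <;> simp [hx]

omit [Fintype ι] in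
/-- Levels above the top are empty: `D n = 0` for `n > d` when all levels are `≤ d`. [folklore] -/
theorem levelProj_eq_zero_of_lt (hD : ∀ ℓ, D ℓ = Matrix.diagonal fun a => if lvl a = ℓ then (1 : K) else 0)
    {d n : ℕ} (hlvl : ∀ a, lvl a ≤ d) (hn : d < n) : D n = 0 := by
  rw [hD n, ← Matrix.diagonal_zero]
  congr 1
  funext x
  have : lvl x ≠ n := fun h => by have := hlvl x; omega
  simp [this]

omit [Fintype ι] in
/-- The level projectors form a partition of unity: `Σ_{ℓ ≤ d} D ℓ = 1`. [folklore] -/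
theorem sum_levelProj_eq_one (hD : ∀ ℓ, D ℓ = Matrix.diagonal fun a => if lvl a = ℓ then (1 : K) else 0)
    {d : ℕ} (hlvl : ∀ a, lvl a ≤ d) : ∑ ℓ ∈ Finset.range (d + 1), D ℓ = 1 := by
  ext a b
  simp only [Matrix.sum_apply, hD, Matrix.diagonal_apply, Matrix.one_apply]
  by_cases hab : a = b
  · subst hab
    simp [Finset.sum_ite_eq, Finset.mem_range, Nat.lt_succ_of_le (hlvl a)]
  · simp [hab]

/-- The commutation rule for the abstract projector family. [folklore] -/
theorem levelProj_comm (hD : ∀ ℓ, D ℓ = Matrix.diagonal fun a => if lvl a = ℓ then (1 : K) else 0)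
    (A : Matrix ι ι K) (hA : ∀ a b, A a b ≠ 0 → lvl b = lvl a + 1) (ℓ : ℕ) :
    D ℓ * A = A * D (ℓ + 1) := by
  rw [hD, hD]; exact diagonal_level_mul_eq lvl A hA ℓ

/-- **A levelled matrix with levels `≤ d` satisfies `A^(d+1) = 0`.** [folklore] -/
theorem pow_succ_eq_zero_of_levelled (hD : ∀ ℓ, D ℓ = Matrix.diagonal fun a => if lvl a = ℓ then (1 : K) else 0)
    {d : ℕ} (hlvl : ∀ a, lvl a ≤ d) (A : Matrix ι ι K) (hA : ∀ a b, A a b ≠ 0 → lvl b = lvl a + 1) :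
    A ^ (d + 1) = 0 := by
  calc A ^ (d + 1) = (∑ ℓ ∈ Finset.range (d + 1), D ℓ) * A ^ (d + 1) := by
        rw [sum_levelProj_eq_one lvl D hD hlvl, Matrix.one_mul]
    _ = ∑ ℓ ∈ Finset.range (d + 1), A ^ (d + 1) * D (ℓ + (d + 1)) := by
        rw [Finset.sum_mul]
        exact Finset.sum_congr rfl fun ℓ _ => intertwine_pow D A (levelProj_comm lvl D hD A hA) (d + 1) ℓ
    _ = 0 := Finset.sum_eq_zero fun ℓ _ => by
        rw [levelProj_eq_zero_of_lt lvl D hD hlvl (by omega : d < ℓ + (d + 1)), Matrix.mul_zero]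

/-- **Decomposition of a levelled direction**: `U = Σ_{j<d} D j · U · D (j+1)`. [folklore] -/
theorem levelled_eq_sum_proj_mul_mul_proj
    (hD : ∀ ℓ, D ℓ = Matrix.diagonal fun a => if lvl a = ℓ then (1 : K) else 0)
    {d : ℕ} (hlvl : ∀ a, lvl a ≤ d) (U : Matrix ι ι K) (hU : ∀ a b, U a b ≠ 0 → lvl b = lvl a + 1) :
    U = ∑ j ∈ Finset.range d, D j * U * D (j + 1) := by
  have hcomm := levelProj_comm lvl D hD U hU
  have hterm : ∀ j, D j * U * D (j + 1) = D j * U := fun j => by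
    rw [Matrix.mul_assoc, ← hcomm j, ← Matrix.mul_assoc, levelProj_mul_self lvl D hD]
  have htop : D d * U = 0 := by
    rw [hcomm d, levelProj_eq_zero_of_lt lvl D hD hlvl (Nat.lt_succ_self d), Matrix.mul_zero]
  calc U = (∑ ℓ ∈ Finset.range (d + 1), D ℓ) * U := by
        rw [sum_levelProj_eq_one lvl D hD hlvl, Matrix.one_mul]
    _ = ∑ ℓ ∈ Finset.range d, D ℓ * U := by
        rw [Finset.sum_mul, Finset.sum_range_succ, htop, add_zero]
    _ = ∑ j ∈ Finset.range d, D j * U * D (j + 1) := Finset.sum_congr rfl fun j _ => (hterm j).symm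

/-- **Path block between two levels**: `D i · (Σ_{k≤d} A^k) · D j = A^(j−i) · D j` for `i ≤ j ≤ d`.
[folklore] -/
theorem proj_mul_pathSum_mul_proj_of_le
    (hD : ∀ ℓ, D ℓ = Matrix.diagonal fun a => if lvl a = ℓ then (1 : K) else 0)
    (A : Matrix ι ι K) (hA : ∀ a b, A a b ≠ 0 → lvl b = lvl a + 1) {d i j : ℕ} (hij : i ≤ j) (hj : j ≤ d) :
    D i * (∑ k ∈ Finset.range (d + 1), A ^ k) * D j = A ^ (j - i) * D j := by
  have hcomm := levelProj_comm lvl D hD A hA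
  rw [Finset.mul_sum, Finset.sum_mul]
  have hk : ∀ k, D i * A ^ k * D j = A ^ k * (D (i + k) * D j) := fun k => by
    rw [intertwine_pow D A hcomm k i, Matrix.mul_assoc]
  simp_rw [hk]
  rw [Finset.sum_eq_single (j - i)]
  · rw [show i + (j - i) = j by omega, levelProj_mul_self lvl D hD]
  · intro k _ hk'
    rw [levelProj_mul_levelProj_of_ne lvl D hD (by omega : i + k ≠ j), Matrix.mul_zero]
  · intro h
    exact absurd (Finset.mem_range.mpr (by omega : j - i < d + 1)) h

/-- … and `= 0` for `j < i` (paths only go up). [folklore] -/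
theorem proj_mul_pathSum_mul_proj_of_lt
    (hD : ∀ ℓ, D ℓ = Matrix.diagonal fun a => if lvl a = ℓ then (1 : K) else 0)
    (A : Matrix ι ι K) (hA : ∀ a b, A a b ≠ 0 → lvl b = lvl a + 1) {d i j : ℕ} (hji : j < i) :
    D i * (∑ k ∈ Finset.range (d + 1), A ^ k) * D j = 0 := by
  have hcomm := levelProj_comm lvl D hD A hA
  rw [Finset.mul_sum, Finset.sum_mul]
  refine Finset.sum_eq_zero fun k _ => ?_
  rw [intertwine_pow D A hcomm k i, Matrix.mul_assoc,
    levelProj_mul_levelProj_of_ne lvl D hD (by omega : i + k ≠ j), Matrix.mul_zero]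

/-- The corner weight starts at level `0` and ends at level `d`: `D d · E = E`, `E · D 0 = E`,
and the other projectors kill it. [folklore] -/
theorem levelProj_mul_corner (hD : ∀ ℓ, D ℓ = Matrix.diagonal fun a => if lvl a = ℓ then (1 : K) else 0)
    {d : ℕ} (E : Matrix ι ι K) (hE : ∀ a b, E a b ≠ 0 → lvl a = d ∧ lvl b = 0) (ℓ : ℕ) :
    D ℓ * E = if ℓ = d then E else 0 := by
  ext a b
  rw [hD, Matrix.diagonal_mul]
  by_cases h : E a b = 0
  · by_cases hℓ : ℓ = d
    · subst hℓ; simp [h]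
    · simp [h, hℓ]
  · have hl := (hE a b h).1
    by_cases hℓ : ℓ = d
    · subst hℓ; simp [hl]
    · have hne : lvl a ≠ ℓ := fun h' => hℓ (h'.symm.trans hl)
      simp [hne, hℓ]

/-- `E · D ℓ = [ℓ = 0]·E`. [folklore] -/
theorem corner_mul_levelProj (hD : ∀ ℓ, D ℓ = Matrix.diagonal fun a => if lvl a = ℓ then (1 : K) else 0)
    {d : ℕ} (E : Matrix ι ι K) (hE : ∀ a b, E a b ≠ 0 → lvl a = d ∧ lvl b = 0) (ℓ : ℕ) :
    E * D ℓ = if ℓ = 0 then E else 0 := by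
  ext a b
  rw [hD, Matrix.mul_diagonal]
  by_cases h : E a b = 0
  · by_cases hℓ : ℓ = 0
    · subst hℓ; simp [h]
    · simp [h, hℓ]
  · have hl := (hE a b h).2
    by_cases hℓ : ℓ = 0
    · subst hℓ; simp [hl]
    · have hne : lvl b ≠ ℓ := fun h' => hℓ (h'.symm.trans hl)
      simp [hne, hℓ]

/-- **Closing path, arriving side**: `E · (Σ_{k≤d} A^k) · D i = E · A^i · D i` (`i ≤ d`): from level `0`
the only path to level `i` has length `i`. [folklore] -/
theorem corner_mul_pathSum_mul_proj
    (hD : ∀ ℓ, D ℓ = Matrix.diagonal fun a => if lvl a = ℓ then (1 : K) else 0)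
    (A E : Matrix ι ι K) (hA : ∀ a b, A a b ≠ 0 → lvl b = lvl a + 1) {d : ℕ}
    (hE : ∀ a b, E a b ≠ 0 → lvl a = d ∧ lvl b = 0) {i : ℕ} (hi : i ≤ d) :
    E * (∑ k ∈ Finset.range (d + 1), A ^ k) * D i = E * A ^ i * D i := by
  have hcomm := levelProj_comm lvl D hD A hA
  have hE0 : E * D 0 = E := by rw [corner_mul_levelProj lvl D hD E hE 0, if_pos rfl]
  have hk : ∀ k, E * A ^ k * D i = E * A ^ k * (D k * D i) := fun k => by
    conv_lhs => rw [← hE0]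
    rw [Matrix.mul_assoc E (D 0), intertwine_pow D A hcomm k 0, zero_add, ← Matrix.mul_assoc,
      Matrix.mul_assoc]
  rw [Finset.mul_sum, Finset.sum_mul, Finset.sum_congr rfl fun k _ => hk k,
    Finset.sum_eq_single i]
  · rw [levelProj_mul_self lvl D hD]
  · intro k _ hki
    rw [levelProj_mul_levelProj_of_ne lvl D hD hki, Matrix.mul_zero]
  · intro h
    exact absurd (Finset.mem_range.mpr (Nat.lt_succ_of_le hi)) h

/-- **Closing path, leaving side**: `D j · (Σ_{k≤d} A^k) · E = A^(d−j) · E` (`j ≤ d`): from level `j` the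
only path to the corner's level `d` has length `d − j`. [folklore] -/
theorem proj_mul_pathSum_mul_corner
    (hD : ∀ ℓ, D ℓ = Matrix.diagonal fun a => if lvl a = ℓ then (1 : K) else 0)
    (A E : Matrix ι ι K) (hA : ∀ a b, A a b ≠ 0 → lvl b = lvl a + 1) {d : ℕ}
    (hE : ∀ a b, E a b ≠ 0 → lvl a = d ∧ lvl b = 0) {j : ℕ} (hj : j ≤ d) :
    D j * (∑ k ∈ Finset.range (d + 1), A ^ k) * E = A ^ (d - j) * E := by
  have hcomm := levelProj_comm lvl D hD A hA
  have hk : ∀ k, D j * A ^ k * E = A ^ k * (D (j + k) * E) := fun k => by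
    rw [intertwine_pow D A hcomm k j, Matrix.mul_assoc]
  rw [Finset.mul_sum, Finset.sum_mul, Finset.sum_congr rfl fun k _ => hk k,
    Finset.sum_eq_single (d - j)]
  · rw [levelProj_mul_corner lvl D hD E hE, if_pos (by omega : j + (d - j) = d)]
  · intro k _ hk'
    rw [levelProj_mul_corner lvl D hD E hE, if_neg (by omega : j + k ≠ d), Matrix.mul_zero]
  · intro h
    exact absurd (Finset.mem_range.mpr (by omega : d - j < d + 1)) h

end ClosedForms

end Summit.ValiantsHypothesis.ValiantsHypothesis.Cruxes.TwoDimCoefficients.DimTwoCases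

end
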